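import Literature.AlgebraicGeometry.Resolution.TranscendenceDefect
import Mathlib.FieldTheory.Minpoly.Field
import Mathlib.RingTheory.PrincipalIdealDomain
import Mathlib.Algebra.Polynomial.Derivative
import Mathlib.Algebra.Polynomial.FieldDivision
import Mathlib.RingTheory.Polynomial.Tower
import Mathlib.RingTheory.Ideal.Operations
import HarnessLib

/-!
# Hensel-root charts: spans of parameters and residues of polynomial values (helpers)

Crux `Valuative.LuAlphaPTorsor` (item `stmt-ResolutionOfSingularities-0641`), line
`pfaff-line-log-final-forms`, helpers for the registered stub `stub_henselRootChart` (the base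
"very good chart" of an intermediate field along a zero-dimensional Abhyankar place, from
Knaf–Kuhlmann 2005, Thm. 3.4 in Hensel-root form); registered helper sub-goal
`exists_cofactor_minpoly`.

Setting: `K ⊇ k` fields, `O` a valuation ring of `K` containing `k`, `x₁, …, xₙ ∈ K`.
Throughout, "`(x) S`" — written out as the set `{z | ∃ r, (∀ i, rᵢ ∈ S) ∧ z = ∑ rᵢ xᵢ}`, no
definition — is the set of combinations `∑ rᵢ xᵢ` with coefficients `rᵢ` in a subring `S` of
`K`; for a `k`-subalgebra `S ∋ xᵢ` it is the ideal of `S` generated by the `xᵢ`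
(`mem_sp_iff_mem_span`).

* `zero_mem_sp`, `self_mem_sp`, `add_mem_sp`, `neg_mem_sp`, `sum_mem_sp`, `mul_mem_sp_left`,
  `mul_mem_sp_right`, `sp_mono`, `valuation_lt_one_of_mem_sp` (`v < 1` on `(x) S` when `S ⊆ O` and `v(xᵢ) < 1`).
* `coe_aeval_mk`, `residue_aeval_mk`, `valuation_aeval_lt_one_iff`, `valuation_aeval_eq_one_iff`
  — for `g ∈ k[X]` and `η ∈ O`: `v(g(η)) < 1 ↔ ḡ(η̄) = 0` in the residue field of `O`.
* `eval_sub_aeval_mem_sp`, `coeff_derivative_sub_mem_sp` — if the coefficients of `P ∈ K[X]`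
  and `Q ∈ k[X]` agree modulo `(x) S` then so do `P(η)`, `Q(η)` and `P'`, `Q'`.
* `exists_cofactor_minpoly` — a simple root `θ` of `Q ∈ k[X]` (`Q(θ) = 0 ≠ Q'(θ)`):
  `Q = Φ Ψ` with `Φ` the minimal polynomial of `θ`, `Ψ(θ) ≠ 0`, `Φ, Ψ` coprime.
* `forall_exists_const`, `forall_exists_poly` — "every element of `k[S]` is a constant (resp. a
  polynomial in `η`) modulo `(x)`" is checked on generators.
* `span_eq_centre` — THE CRITERION: if `R ⊆ O` is a `k`-subalgebra containing the `xᵢ`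
  (`v(xᵢ) < 1`) and `η`, every `z ∈ R` is `≡ g(η) (mod (x) R)` for some `g ∈ k[X]`, and
  `Φ(η) ∈ (x) R` for the minimal polynomial `Φ` of the residue `η̄` over `k`, then the centre
  `𝔪_O ∩ R` is generated by `x₁, …, xₙ` (if `v(z) < 1` then `v(g(η)) < 1`, `ḡ(η̄) = 0`, `Φ ∣ g`,
  `g(η) ∈ Φ(η) R ⊆ (x) R`).
-/

-- single-problem summit: the doubled namespace component `ResolutionOfSingularities` is forced
set_option linter.dupNamespace false

namespace Summit.ResolutionOfSingularities.ResolutionOfSingularities.Theorems.PfaffLine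

open IsLocalRing Polynomial Literature.AlgebraicGeometry.Resolution

variable {K : Type} [Field K]

/-! ### The span of the parameters with coefficients in a subring -/

section ParamSpan

variable {σ : Type} [SetLike σ K] {n : ℕ} {x : Fin n → K}

/-- Enlarging the coefficient ring. [folklore] -/
theorem sp_mono {τ : Type} [SetLike τ K] {S : σ} {T : τ} (h : ∀ z ∈ S, z ∈ T) {z : K}
    (hz : z ∈ {z | ∃ r : Fin n → K, (∀ i, r i ∈ S) ∧ z = ∑ i, r i * x i}) :
    z ∈ {z | ∃ r : Fin n → K, (∀ i, r i ∈ T) ∧ z = ∑ i, r i * x i} := by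
  obtain ⟨r, hr, rfl⟩ := hz
  exact ⟨r, fun i => h _ (hr i), rfl⟩

/-- Elements of `(x) S` have value `< 1` when `S ⊆ O` and `v(xᵢ) < 1`. [folklore] -/
theorem valuation_lt_one_of_mem_sp {S : σ} (O : ValuationSubring K) (hS : ∀ s ∈ S, s ∈ O)
    (hvx : ∀ i, O.valuation (x i) < 1) {z : K}
    (hz : z ∈ {z | ∃ r : Fin n → K, (∀ i, r i ∈ S) ∧ z = ∑ i, r i * x i}) :
    O.valuation z < 1 := by
  obtain ⟨r, hr, rfl⟩ := hz
  refine Valuation.map_sum_lt _ one_ne_zero fun i _ => ?_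
  rw [map_mul]
  exact mul_lt_of_le_one_of_lt ((O.valuation_le_one_iff _).mpr (hS _ (hr i))) (hvx i)

variable [SubringClass σ K]

/-- `0 ∈ (x) S`. [folklore] -/
theorem zero_mem_sp (S : σ) :
    (0 : K) ∈ {z | ∃ r : Fin n → K, (∀ i, r i ∈ S) ∧ z = ∑ i, r i * x i} :=
  ⟨0, fun _ => zero_mem S, by simp⟩

/-- `xᵢ ∈ (x) S`. [folklore] -/
theorem self_mem_sp (S : σ) (i : Fin n) :
    x i ∈ {z | ∃ r : Fin n → K, (∀ i, r i ∈ S) ∧ z = ∑ i, r i * x i} := by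
  classical
  refine ⟨fun j => if j = i then 1 else 0, fun j => ?_, ?_⟩
  · dsimp only
    split_ifs
    · exact one_mem S
    · exact zero_mem S
  · simp only [ite_mul, one_mul, zero_mul, Finset.sum_ite_eq', Finset.mem_univ, if_true]

variable {S : σ}

/-- `(x) S` is closed under addition. [folklore] -/
theorem add_mem_sp {z w : K}
    (hz : z ∈ {z | ∃ r : Fin n → K, (∀ i, r i ∈ S) ∧ z = ∑ i, r i * x i})
    (hw : w ∈ {z | ∃ r : Fin n → K, (∀ i, r i ∈ S) ∧ z = ∑ i, r i * x i}) :
    z + w ∈ {z | ∃ r : Fin n → K, (∀ i, r i ∈ S) ∧ z = ∑ i, r i * x i} := by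
  obtain ⟨r, hr, rfl⟩ := hz
  obtain ⟨s, hs, rfl⟩ := hw
  refine ⟨r + s, fun i => add_mem (hr i) (hs i), ?_⟩
  rw [← Finset.sum_add_distrib]
  exact Finset.sum_congr rfl fun i _ => by rw [Pi.add_apply, add_mul]

/-- `(x) S` is closed under left multiplication by `S`. [folklore] -/
theorem mul_mem_sp_left {a z : K} (ha : a ∈ S)
    (hz : z ∈ {z | ∃ r : Fin n → K, (∀ i, r i ∈ S) ∧ z = ∑ i, r i * x i}) :
    a * z ∈ {z | ∃ r : Fin n → K, (∀ i, r i ∈ S) ∧ z = ∑ i, r i * x i} := by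
  obtain ⟨r, hr, rfl⟩ := hz
  refine ⟨fun i => a * r i, fun i => mul_mem ha (hr i), ?_⟩
  rw [Finset.mul_sum]
  exact Finset.sum_congr rfl fun i _ => by rw [mul_assoc]

/-- `(x) S` is closed under right multiplication by `S`. [folklore] -/
theorem mul_mem_sp_right {a z : K}
    (hz : z ∈ {z | ∃ r : Fin n → K, (∀ i, r i ∈ S) ∧ z = ∑ i, r i * x i}) (ha : a ∈ S) :
    z * a ∈ {z | ∃ r : Fin n → K, (∀ i, r i ∈ S) ∧ z = ∑ i, r i * x i} := by
  rw [mul_comm]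
  exact mul_mem_sp_left ha hz

/-- `(x) S` is closed under negation. [folklore] -/
theorem neg_mem_sp {z : K}
    (hz : z ∈ {z | ∃ r : Fin n → K, (∀ i, r i ∈ S) ∧ z = ∑ i, r i * x i}) :
    -z ∈ {z | ∃ r : Fin n → K, (∀ i, r i ∈ S) ∧ z = ∑ i, r i * x i} := by
  rw [← neg_one_mul]
  exact mul_mem_sp_left (neg_mem (one_mem S)) hz

/-- `(x) S` is closed under finite sums. [folklore] -/
theorem sum_mem_sp {ι : Type} (t : Finset ι) {f : ι → K}
    (hf : ∀ i ∈ t, f i ∈ {z | ∃ r : Fin n → K, (∀ i, r i ∈ S) ∧ z = ∑ i, r i * x i}) :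
    (∑ i ∈ t, f i) ∈ {z | ∃ r : Fin n → K, (∀ i, r i ∈ S) ∧ z = ∑ i, r i * x i} := by
  classical
  induction t using Finset.induction_on with
  | empty => rw [Finset.sum_empty]; exact zero_mem_sp S
  | insert a t hat ih =>
    rw [Finset.sum_insert hat]
    exact add_mem_sp (hf a (Finset.mem_insert_self a t))
      (ih fun i hi => hf i (Finset.mem_insert_of_mem hi))

/-- For a `k`-subalgebra `R ∋ xᵢ`, membership in `(x) R` is membership in the ideal of
`R.toSubring` generated by the `xᵢ`. [folklore] -/
theorem mem_sp_iff_mem_span {k : Type} [Field k] [Algebra k K] (R : Subalgebra k K)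
    (hx : ∀ i, x i ∈ R) {z : K} (hz : z ∈ R) :
    z ∈ {z | ∃ r : Fin n → K, (∀ i, r i ∈ R) ∧ z = ∑ i, r i * x i} ↔
      (⟨z, hz⟩ : R.toSubring) ∈ Ideal.span (Set.range fun i => (⟨x i, hx i⟩ : R.toSubring)) := by
  rw [Ideal.mem_span_range_iff_exists_fun]
  constructor
  · rintro ⟨r, hr, hzr⟩
    refine ⟨fun i => ⟨r i, hr i⟩, Subtype.ext ?_⟩
    have h := map_sum R.toSubring.subtype (fun i => (⟨r i, hr i⟩ : R.toSubring) * ⟨x i, hx i⟩)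
      Finset.univ
    simp only [map_mul, Subring.coe_subtype] at h
    exact h.trans hzr.symm
  · rintro ⟨c, hc⟩
    refine ⟨fun i => (c i : K), fun i => (c i).2, ?_⟩
    have h := map_sum R.toSubring.subtype (fun i => c i * ⟨x i, hx i⟩) Finset.univ
    simp only [map_mul, Subring.coe_subtype] at h
    rw [hc] at h
    exact h

end ParamSpan

/-! ### Values and residues of `g(η)`, `g ∈ k[X]`, `η ∈ O` -/

section Residue

variable {k : Type} [Field k] [Algebra k K] (O : ValuationSubring K)

/-- `g(η)` computed in `O` and in `K` agree. [folklore] -/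
theorem coe_aeval_mk (hk : ∀ c : k, algebraMap k K c ∈ O) {η : K} (hη : η ∈ O) (g : k[X]) :
    letI := algebraOfMem k O hk
    ((aeval (⟨η, hη⟩ : O) g : O) : K) = aeval η g := by
  letI := algebraOfMem k O hk
  haveI := isScalarTower_algebraOfMem k O hk
  exact (aeval_algebraMap_apply K (⟨η, hη⟩ : O) g).symm

/-- `g(η) ∈ O` for `η ∈ O`. [folklore] -/
theorem aeval_mem_valuationSubring (hk : ∀ c : k, algebraMap k K c ∈ O) {η : K} (hη : η ∈ O)
    (g : k[X]) : aeval η g ∈ O := by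
  rw [← coe_aeval_mk O hk hη g]
  exact Subtype.coe_prop _

/-- The residue of `g(η)` is `ḡ(η̄)`. [folklore] -/
theorem residue_aeval_mk (hk : ∀ c : k, algebraMap k K c ∈ O) {η : K} (hη : η ∈ O) (g : k[X]) :
    letI := algebraOfMem k O hk
    residue O (aeval (⟨η, hη⟩ : O) g) = aeval (residue O ⟨η, hη⟩) g := by
  letI := algebraOfMem k O hk
  have h := aeval_algHom_apply (IsScalarTower.toAlgHom k O (ResidueField O)) (⟨η, hη⟩ : O) g
  simp only [IsScalarTower.coe_toAlgHom', ResidueField.algebraMap_eq] at h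
  exact h.symm

/-- `v(g(η)) < 1 ↔ ḡ(η̄) = 0`. [folklore] -/
theorem valuation_aeval_lt_one_iff (hk : ∀ c : k, algebraMap k K c ∈ O) {η : K} (hη : η ∈ O)
    (g : k[X]) :
    letI := algebraOfMem k O hk
    O.valuation (aeval η g) < 1 ↔ aeval (residue O ⟨η, hη⟩) g = 0 := by
  letI := algebraOfMem k O hk
  rw [← residue_aeval_mk O hk hη g, residue_eq_zero_iff, ValuationSubring.valuation_lt_one_iff,
    coe_aeval_mk O hk hη g]

/-- `v(g(η)) ≤ 1`. [folklore] -/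
theorem valuation_aeval_le_one (hk : ∀ c : k, algebraMap k K c ∈ O) {η : K} (hη : η ∈ O)
    (g : k[X]) : O.valuation (aeval η g) ≤ 1 :=
  (O.valuation_le_one_iff _).mpr (aeval_mem_valuationSubring O hk hη g)

/-- `v(g(η)) = 1 ↔ ḡ(η̄) ≠ 0`. [folklore] -/
theorem valuation_aeval_eq_one_iff (hk : ∀ c : k, algebraMap k K c ∈ O) {η : K} (hη : η ∈ O)
    (g : k[X]) :
    letI := algebraOfMem k O hk
    O.valuation (aeval η g) = 1 ↔ aeval (residue O ⟨η, hη⟩) g ≠ 0 := by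
  letI := algebraOfMem k O hk
  rw [Ne, ← valuation_aeval_lt_one_iff O hk hη g, not_lt]
  exact ⟨fun h => h.ge, fun h => le_antisymm (valuation_aeval_le_one O hk hη g) h⟩

/-- Ultrametric bookkeeping: if `v(a - b) < 1`, `v(a) = 1` and `v(b) ≤ 1` then `v(b) = 1`.
[folklore] -/
theorem valuation_eq_one_of_sub_lt {a b : K} (hab : O.valuation (a - b) < 1)
    (ha : O.valuation a = 1) (hb : O.valuation b ≤ 1) : O.valuation b = 1 := by
  refine le_antisymm hb (not_lt.mp fun hlt => ?_)
  have h : O.valuation a < 1 := by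
    have e : a = (a - b) + b := by ring
    rw [e]
    exact Valuation.map_add_lt _ hab hlt
  exact h.ne ha

end Residue

/-! ### Polynomials with congruent coefficients -/

section Congruence

variable {k : Type} [Field k] [Algebra k K] {n : ℕ} {x : Fin n → K}
  {σ : Type} [SetLike σ K] [SubringClass σ K] {S : σ}

/-- `g(η) ∈ R` for a `k`-subalgebra `R ∋ η`. [folklore] -/
theorem aeval_mem_subalgebra (R : Subalgebra k K) {η : K} (hη : η ∈ R) (g : k[X]) :
    aeval η g ∈ R := by
  rw [aeval_eq_sum_range]
  exact sum_mem fun i _ => R.smul_mem (pow_mem hη i) _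

/-- If the coefficients of `P ∈ K[X]` and `Q ∈ k[X]` agree modulo `(x) S` and `η ∈ S`, then
`P(η) ≡ Q(η) (mod (x) S)`. [folklore] -/
theorem eval_sub_aeval_mem_sp {η : K} (hη : η ∈ S) {P : K[X]} {Q : k[X]}
    (h : ∀ i, P.coeff i - algebraMap k K (Q.coeff i) ∈
      {z | ∃ r : Fin n → K, (∀ i, r i ∈ S) ∧ z = ∑ i, r i * x i}) :
    P.eval η - aeval η Q ∈ {z | ∃ r : Fin n → K, (∀ i, r i ∈ S) ∧ z = ∑ i, r i * x i} := by
  rw [eval_eq_sum_range' (n := max P.natDegree Q.natDegree + 1) (by omega) η,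
    aeval_eq_sum_range' (n := max P.natDegree Q.natDegree + 1) (by omega) η,
    ← Finset.sum_sub_distrib]
  refine sum_mem_sp _ fun i _ => ?_
  rw [Algebra.smul_def, ← sub_mul]
  exact mul_mem_sp_right (h i) (pow_mem hη i)

/-- Congruent coefficients have congruent derivatives. [folklore] -/
theorem coeff_derivative_sub_mem_sp {P : K[X]} {Q : k[X]}
    (h : ∀ i, P.coeff i - algebraMap k K (Q.coeff i) ∈
      {z | ∃ r : Fin n → K, (∀ i, r i ∈ S) ∧ z = ∑ i, r i * x i}) (i : ℕ) :
    (derivative P).coeff i - algebraMap k K ((derivative Q).coeff i) ∈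
      {z | ∃ r : Fin n → K, (∀ i, r i ∈ S) ∧ z = ∑ i, r i * x i} := by
  rw [coeff_derivative, coeff_derivative, map_mul, map_add, map_natCast, map_one, ← sub_mul]
  exact mul_mem_sp_right (h (i + 1)) (add_mem (natCast_mem S i) (one_mem S))

end Congruence

/-! ### A simple root of `Q ∈ k[X]`: `Q = Φ Ψ`, `Φ` the minimal polynomial, `Ψ(θ) ≠ 0` -/

/-- **Registered helper sub-goal.** If `θ` is a simple root of `Q ∈ k[X]` (`Q(θ) = 0`,
`Q'(θ) ≠ 0`), then `θ` is integral over `k` and `Q = Φ Ψ` with `Φ` the minimal polynomial of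
`θ`, `Ψ(θ) ≠ 0` and `Φ, Ψ` coprime (`Φ ∣ Q`; `Q' = Φ'Ψ + ΦΨ'` at `θ` gives `Ψ(θ) ≠ 0`; `Φ` is
irreducible and does not divide `Ψ`). [folklore] -/
theorem exists_cofactor_minpoly :
    ∀ (k κ : Type) [Field k] [Field κ] [Algebra k κ] (θ : κ) (Q : Polynomial k), Polynomial.aeval θ Q = 0 → Polynomial.aeval θ (Polynomial.derivative Q) ≠ 0 → IsIntegral k θ ∧ ∃ Ψ : Polynomial k, Q = minpoly k θ * Ψ ∧ Polynomial.aeval θ Ψ ≠ 0 ∧ IsCoprime (minpoly k θ) Ψ := by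
  intro k κ _ _ _ θ Q h0 h1
  have hQ0 : Q ≠ 0 := by
    rintro rfl
    exact h1 (by rw [derivative_zero, map_zero])
  have halg : IsAlgebraic k θ := ⟨Q, hQ0, h0⟩
  have hint : IsIntegral k θ := halg.isIntegral
  obtain ⟨Ψ, hΨ⟩ := minpoly.dvd k θ h0
  have hΨθ : aeval θ Ψ ≠ 0 := by
    intro hz
    apply h1
    rw [hΨ, derivative_mul, map_add, map_mul, map_mul, minpoly.aeval, hz, zero_mul, mul_zero,
      add_zero]
  refine ⟨hint, Ψ, hΨ, hΨθ, (minpoly.irreducible hint).coprime_iff_not_dvd.mpr fun hdvd => hΨθ ?_⟩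
  obtain ⟨q, rfl⟩ := hdvd
  rw [map_mul, minpoly.aeval, zero_mul]

/-! ### Congruences modulo `(x)` are checked on generators -/

section Generators

variable {k : Type} [Field k] [Algebra k K] {n : ℕ} {x : Fin n → K}

/-- If every generator `s ∈ S` is a constant modulo `(x) k[S]`, so is every element of `k[S]`.
[folklore] -/
theorem forall_exists_const {S : Set K}
    (hS : ∀ s ∈ S, ∃ c : k, s - algebraMap k K c ∈
      {z | ∃ r : Fin n → K, (∀ i, r i ∈ Algebra.adjoin k S) ∧ z = ∑ i, r i * x i}) :
    ∀ z ∈ Algebra.adjoin k S, ∃ c : k, z - algebraMap k K c ∈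
      {z | ∃ r : Fin n → K, (∀ i, r i ∈ Algebra.adjoin k S) ∧ z = ∑ i, r i * x i} := by
  intro z hz
  refine Algebra.adjoin_induction (fun s hs => hS s hs) (fun c => ?_) (fun a b _ _ ha hb => ?_)
    (fun a b ha' _ ha hb => ?_) hz
  · exact ⟨c, by rw [sub_self]; exact zero_mem_sp _⟩
  · obtain ⟨c₁, h₁⟩ := ha
    obtain ⟨c₂, h₂⟩ := hb
    exact ⟨c₁ + c₂, by rw [map_add, add_sub_add_comm]; exact add_mem_sp h₁ h₂⟩
  · obtain ⟨c₁, h₁⟩ := ha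
    obtain ⟨c₂, h₂⟩ := hb
    refine ⟨c₁ * c₂, ?_⟩
    have e : a * b - algebraMap k K (c₁ * c₂) =
        a * (b - algebraMap k K c₂) + (a - algebraMap k K c₁) * algebraMap k K c₂ := by
      rw [map_mul]; ring
    rw [e]
    exact add_mem_sp (mul_mem_sp_left ha' h₂)
      (mul_mem_sp_right h₁ (Subalgebra.algebraMap_mem _ c₂))

/-- If every generator `s ∈ S` is a polynomial in `η ∈ k[S]` with constant coefficients modulo
`(x) k[S]`, so is every element of `k[S]`. [folklore] -/
theorem forall_exists_poly {S : Set K} {η : K} (hη : η ∈ Algebra.adjoin k S)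
    (hS : ∀ s ∈ S, ∃ g : k[X], s - aeval η g ∈
      {z | ∃ r : Fin n → K, (∀ i, r i ∈ Algebra.adjoin k S) ∧ z = ∑ i, r i * x i}) :
    ∀ z ∈ Algebra.adjoin k S, ∃ g : k[X], z - aeval η g ∈
      {z | ∃ r : Fin n → K, (∀ i, r i ∈ Algebra.adjoin k S) ∧ z = ∑ i, r i * x i} := by
  intro z hz
  refine Algebra.adjoin_induction (fun s hs => hS s hs) (fun c => ?_) (fun a b _ _ ha hb => ?_)
    (fun a b ha' _ ha hb => ?_) hz
  · exact ⟨C c, by rw [aeval_C, sub_self]; exact zero_mem_sp _⟩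
  · obtain ⟨g₁, h₁⟩ := ha
    obtain ⟨g₂, h₂⟩ := hb
    exact ⟨g₁ + g₂, by rw [map_add, add_sub_add_comm]; exact add_mem_sp h₁ h₂⟩
  · obtain ⟨g₁, h₁⟩ := ha
    obtain ⟨g₂, h₂⟩ := hb
    refine ⟨g₁ * g₂, ?_⟩
    have e : a * b - aeval η (g₁ * g₂) = a * (b - aeval η g₂) + (a - aeval η g₁) * aeval η g₂ := by
      rw [map_mul]; ring
    rw [e]
    exact add_mem_sp (mul_mem_sp_left ha' h₂)
      (mul_mem_sp_right h₁ (aeval_mem_subalgebra _ hη g₂))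

end Generators

/-! ### The criterion: the centre is generated by the parameters -/

/-- **The centre of a Hensel-root chart is generated by the parameters.** Let `R ⊆ O` be a
`k`-subalgebra containing `x₁, …, xₙ` with `v(xᵢ) < 1` and `η`, such that every `z ∈ R` is
congruent modulo `(x) R` to `g(η)` for some `g ∈ k[X]`, and such that `Φ(η) ∈ (x) R` for the
minimal polynomial `Φ` over `k` of the residue `η̄` of `η`. Then `(x₁, …, xₙ) R = 𝔪_O ∩ R`:
if `v(z) < 1` then `v(g(η)) < 1`, i.e. `ḡ(η̄) = 0`, so `Φ ∣ g` and `g(η) ∈ Φ(η) R ⊆ (x) R`.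
[folklore] -/
theorem span_eq_centre {k : Type} [Field k] [Algebra k K] (O : ValuationSubring K)
    (hk : ∀ c : k, algebraMap k K c ∈ O) (R : Subalgebra k K) (hRO : R.toSubring ≤ O.toSubring)
    {n : ℕ} {x : Fin n → K} (hx : ∀ i, x i ∈ R) (hvx : ∀ i, O.valuation (x i) < 1) {η : K}
    (hηR : η ∈ R)
    (hgen : ∀ z ∈ R, ∃ g : k[X],
      z - aeval η g ∈ {z | ∃ r : Fin n → K, (∀ i, r i ∈ R) ∧ z = ∑ i, r i * x i})
    (hΦ : letI := algebraOfMem k O hk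
      aeval η (minpoly k (residue O ⟨η, hRO hηR⟩)) ∈
        {z | ∃ r : Fin n → K, (∀ i, r i ∈ R) ∧ z = ∑ i, r i * x i}) :
    Ideal.span (Set.range fun i => (⟨x i, hx i⟩ : R.toSubring)) =
      Ideal.comap (Subring.inclusion hRO) (maximalIdeal O) := by
  letI := algebraOfMem k O hk
  have hRO' : ∀ z ∈ R, z ∈ O := fun z hz => hRO hz
  apply le_antisymm
  · rw [Ideal.span_le]
    rintro _ ⟨i, rfl⟩
    exact (ValuationSubring.valuation_lt_one_iff O _).mpr (hvx i)
  · intro z hz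
    have hvz : O.valuation (z : K) < 1 :=
      (ValuationSubring.valuation_lt_one_iff O _).mp (Ideal.mem_comap.mp hz)
    obtain ⟨g, hg⟩ := hgen z z.2
    have hvg : O.valuation (aeval (η : K) g) < 1 := by
      have e : aeval (η : K) g = z - (z - aeval η g) := by ring
      rw [e]
      exact lt_of_le_of_lt (Valuation.map_sub _ _ _)
        (max_lt hvz (valuation_lt_one_of_mem_sp O hRO' hvx hg))
    rw [valuation_aeval_lt_one_iff O hk (hRO hηR)] at hvg
    obtain ⟨h, hh⟩ := minpoly.dvd k _ hvg
    have hzspan : (z : K) ∈ {z | ∃ r : Fin n → K, (∀ i, r i ∈ R) ∧ z = ∑ i, r i * x i} := by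
      have e : (z : K) = (z - aeval η g) + aeval η g := by ring
      rw [e]
      refine add_mem_sp hg ?_
      rw [hh, map_mul]
      exact mul_mem_sp_right hΦ (aeval_mem_subalgebra R hηR h)
    have := (mem_sp_iff_mem_span R hx z.2).mp hzspan
    simpa using this

end Summit.ResolutionOfSingularities.ResolutionOfSingularities.Theorems.PfaffLine
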